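import Summits.BirchSwinnertonDyer.BirchSwinnertonDyer.Theorems.UniversalToricDescentLambdaQuotientRankPrelim
import Mathlib.RingTheory.Ideal.AssociatedPrime.Finiteness
import Mathlib.Algebra.Module.SnakeLemma
import HarnessLib

/-!
# The Euler-characteristic rank formula `rank_{ℤ_p}(X/fX) − rank_{ℤ_p}(X[f]) = deg f · rank_Λ X`
# for a finitely generated `Λ = ℤ_p⟦T⟧`-module and a distinguished polynomial `f`
# (crux ♭T≤ stmt-BirchSwinnertonDyer-23042 `DefectTransportModThreePT`, line `sigmacongruence`, brick (A1b)
# of the growth road to stub TS1′ `stub_twinStrictSurj`)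

Route `UniversalToricDescent`, lead prover `bsd-wall-utd-p1` g16. THEOREMS ONLY (no definition, no named fact,
no `sorry`); `--supports stmt-BirchSwinnertonDyer-23042`. BSD is not proved by any of this.

For a finitely generated module `X` over `Λ = ℤ_p⟦T⟧` (with its compatible `ℤ_p`-structure) and a distinguished
polynomial `f ∈ ℤ_p[T]` of degree `d` (so `Λ/(f) ≅ ℤ_p^d`, tree `IwasawaAlgebra.finrank_quotient_pow`):

  `rank_{ℤ_p} (X/fX) − rank_{ℤ_p} (X[f]) = d · rank_Λ X`     (`finrank_quotient_sub_finrank_torsionBy_eq`),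

`rank_Λ X = Module.finrank Λ X` being the generic rank. Proof: both sides are additive in short exact sequences of
finitely generated `Λ`-modules — the left by the snake lemma for multiplication by `f` (Mathlib `SnakeLemma.δ'`,
verbatim the bookkeeping of `Literature.Algebra.Module.RankModPrimeElement`, there for a PRIME element and ranks
over `R/(t)`; here `Λ/(f)` is not a domain, and the currency is the `ℤ_p`-rank) — and agree on `Λ/𝔮`, `𝔮` prime:
for `𝔮 = 0` both are `d` (`Λ[f] = 0`, `Λ/fΛ ≅ ℤ_p^d`); for `𝔮 ≠ 0` the module is `Λ`-torsion, so `ℚ_p ⊗ X` is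
finite-dimensional (tree `IwasawaAlgebra.finite_baseChange_of_isTorsion`) and `rank X[f] = rank X/fX` is
rank–nullity for the endomorphism `f` (`finrank_quotient_smul_top_eq_finrank_torsionBy`); a finitely generated
module has a prime filtration (`IsNoetherianRing.induction_on_isQuotientEquivQuotientPrime`).

The `ℤ_p`-finiteness of `X/fX`, `X[f]`, the rank bridge `rank_{ℤ_p} X < ℵ₀` for torsion `X`, rank–nullity and the
six-term bookkeeping are in the sibling `…LambdaQuotientRankPrelim`.

References: [Washington1997] §13.2 (Lemma 13.7, Prop. 13.8, Thm. 13.12; `λ` is additive); [GreenbergLNM1716] §1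
pp. 60, 65 (reading the `Λ`-rank off `X/ω_n X`); [NeukirchSchmidtWingberg2008] Ch. V §3 (Euler characteristics of
`Λ`-modules); Greenberg, *On the structure of certain Galois cohomology groups* (2006) §2 A Prop. 2.1, Remark 2.1.3.
-/

-- the Theorems namespace of this sub repeats the summit name by design (D-0017 nested layout)
set_option linter.dupNamespace false

noncomputable section

namespace Summit.BirchSwinnertonDyer.BirchSwinnertonDyer.Theorems.UniversalToricDescentTorsionFreeByCount

open Submodule Function Polynomial Literature.NumberTheory.EllipticCurves
open scoped TensorProduct Cardinal

universe u

variable (p : ℕ) [hp : Fact p.Prime]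

/-! ## The rank formula -/

/-- **`rank_{ℤ_p}(X/fX) − rank_{ℤ_p}(X[f]) = deg f · rank_Λ X`** for a finitely generated `Λ`-module `X` with its
compatible `ℤ_p`-structure and a distinguished polynomial `f` (prime filtration + snake lemma; on `Λ/𝔮`: `d · 1` for
`𝔮 = 0`, and `0` for `𝔮 ≠ 0` by rank–nullity on the torsion module `Λ/𝔮`). [cite: Washington1997, §13.2 (Lemma
13.7, Prop. 13.8, Thm. 13.12)] [cite: NeukirchSchmidtWingberg2008, Ch. V §3] -/
theorem finrank_quotient_sub_finrank_torsionBy_eq {w : ℤ_[p][X]}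
    (hw : w.IsDistinguishedAt (IsLocalRing.maximalIdeal ℤ_[p])) (Q : Type u) [AddCommGroup Q]
    [Module (IwasawaAlgebra p) Q] [hQ : Module.Finite (IwasawaAlgebra p) Q] :
    ∀ [Module ℤ_[p] Q] [IsScalarTower ℤ_[p] (IwasawaAlgebra p) Q],
    (Module.finrank ℤ_[p] (Q ⧸ (Ideal.span {(w : IwasawaAlgebra p)} • ⊤ :
        Submodule (IwasawaAlgebra p) Q)) : ℤ) -
      Module.finrank ℤ_[p] (torsionBy (IwasawaAlgebra p) Q (w : IwasawaAlgebra p)) =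
        w.natDegree * Module.finrank (IwasawaAlgebra p) Q := by
  set R := IwasawaAlgebra p with hRdef
  set t : R := (w : IwasawaAlgebra p) with htdef
  have ht0 : t ≠ 0 := by
    intro h
    apply hw.monic.ne_zero
    rw [htdef] at h
    exact (Polynomial.coe_eq_zero_iff).mp h
  induction hQ using IsNoetherianRing.induction_on_isQuotientEquivQuotientPrime R with
  | subsingleton N =>
    intro _ _
    simp [Module.finrank_zero_of_subsingleton]
  | quotient N 𝔮 e =>
    intro _ _
    by_cases hq0 : 𝔮.asIdeal = ⊥
    · -- `N ≃ Λ`: `N[t] = 0`, `N/tN ≃ Λ/(t)` of rank `deg w`, `rank_Λ N = 1`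
      let e' : N ≃ₗ[R] R := e.trans (Submodule.quotEquivOfEqBot _ hq0)
      have h1 : Module.finrank R N = 1 := by rw [e'.finrank_eq, Module.finrank_self]
      haveI : Subsingleton (torsionBy R N t) := by
        refine ⟨fun a b => ?_⟩
        have hz : ∀ c : torsionBy R N t, c = 0 := fun c => by
          obtain ⟨c, hc⟩ := c
          rw [mem_torsionBy_iff] at hc
          have h0 : t * e' c = 0 := by rw [← smul_eq_mul, ← map_smul, hc, map_zero]
          have hc0 : e' c = 0 := (mul_eq_zero.mp h0).resolve_left ht0
          exact Subtype.ext ((map_eq_zero_iff e' e'.injective).mp hc0)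
        rw [hz a, hz b]
      have hmap : Submodule.map (e' : N →ₗ[R] R) (Ideal.span {t} • ⊤ : Submodule R N) =
          (Ideal.span {t} • ⊤ : Submodule R R) := by
        rw [Submodule.map_smul'', Submodule.map_top, LinearEquiv.range]
      have htop : (Ideal.span {t} • ⊤ : Submodule R R) = Ideal.span {t} := by
        rw [Ideal.smul_eq_mul, Ideal.mul_top]
      let ψ : (N ⧸ (Ideal.span {t} • ⊤ : Submodule R N)) ≃ₗ[R] (R ⧸ Ideal.span {t}) :=
        (Submodule.Quotient.equiv _ _ e' hmap).trans (Submodule.quotEquivOfEq _ _ htop)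
      have h2 : Module.finrank ℤ_[p] (N ⧸ (Ideal.span {t} • ⊤ : Submodule R N)) = w.natDegree := by
        rw [(ψ.restrictScalars ℤ_[p]).finrank_eq]
        have := finrank_quotient_pow p hw 1
        rwa [pow_one, one_mul] at this
      rw [h1, h2, Module.finrank_zero_of_subsingleton]
      simp
    · -- `𝔮 ≠ 0`: `N` is `Λ`-torsion, `rank_Λ N = 0`, `rank N/tN = rank N[t]`
      obtain ⟨q, hq, hqne⟩ := (Submodule.ne_bot_iff _).mp hq0
      have hkill : ∀ x : N, q • x = 0 := fun x => by
        apply e.injective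
        rw [map_smul, map_zero, ← IsScalarTower.algebraMap_smul (R ⧸ 𝔮.asIdeal) q (e x), smul_eq_mul,
          Ideal.Quotient.algebraMap_eq, Ideal.Quotient.eq_zero_iff_mem.mpr hq, zero_mul]
      have hT : Module.IsTorsion R N := fun x => ⟨⟨q, mem_nonZeroDivisors_of_ne_zero hqne⟩, hkill x⟩
      have h1 : Module.finrank R N = 0 :=
        Module.finrank_eq_zero_iff_isTorsion.mpr hT
      have h2 := finrank_quotient_smul_top_eq_finrank_torsionBy p N
        (rank_int_lt_aleph0_of_isTorsion p N hT) t
      rw [h1, h2]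
      simp
  | exact N₁ N₂ N₃ f g hf hg hfg E₁ E₃ =>
    intro _ _
    -- `ℤ_p`-structures on `N₁`, `N₃` by restriction (on `N₂` the given one)
    letI i₁ : Module ℤ_[p] N₁ := Module.compHom N₁ (algebraMap ℤ_[p] R)
    haveI : IsScalarTower ℤ_[p] R N₁ := isScalarTower_compHom p N₁
    letI i₃ : Module ℤ_[p] N₃ := Module.compHom N₃ (algebraMap ℤ_[p] R)
    haveI : IsScalarTower ℤ_[p] R N₃ := isScalarTower_compHom p N₃
    have E₁' := E₁
    have E₃' := E₃
    -- `rank_Λ` is additive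
    have hR : (Module.finrank R N₂ : ℤ) = Module.finrank R N₁ + Module.finrank R N₃ := by
      rw [finrank_eq_finrank_ker_add_finrank_range g, LinearMap.exact_iff.mp hfg,
        ← (LinearEquiv.ofInjective f hf).finrank_eq, LinearMap.range_eq_top.mpr hg, finrank_top]
      push_cast; ring
    -- the snake diagram for multiplication by `t`
    let i₁' : N₁ →ₗ[R] N₁ := t • LinearMap.id
    let i₂' : N₂ →ₗ[R] N₂ := t • LinearMap.id
    let i₃' : N₃ →ₗ[R] N₃ := t • LinearMap.id
    have hc₁ : f ∘ₗ i₁' = i₂' ∘ₗ f := by ext x; simp [i₁', i₂']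
    have hc₂ : g ∘ₗ i₂' = i₃' ∘ₗ g := by ext x; simp [i₂', i₃']
    have hι : ∀ {N : Type u} [AddCommGroup N] [Module R N],
        Exact (torsionBy R N t).subtype (t • LinearMap.id : N →ₗ[R] N) := by
      intro N _ _ x
      constructor
      · intro hx
        exact ⟨⟨x, (mem_torsionBy_iff t x).mpr (by simpa using hx)⟩, rfl⟩
      · rintro ⟨y, rfl⟩
        simp only [Submodule.subtype_apply, LinearMap.smul_apply, LinearMap.id_coe, id_eq]
        exact (mem_torsionBy_iff t (y : N)).mp y.2
    have hπ : ∀ {N : Type u} [AddCommGroup N] [Module R N],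
        Exact (t • LinearMap.id : N →ₗ[R] N) (Ideal.span {t} • ⊤ : Submodule R N).mkQ := by
      intro N _ _ x
      rw [Submodule.mkQ_apply, Submodule.Quotient.mk_eq_zero, Submodule.ideal_span_singleton_smul,
        Submodule.mem_smul_pointwise_iff_exists]
      constructor
      · rintro ⟨b, -, rfl⟩; exact ⟨b, by simp⟩
      · rintro ⟨b, rfl⟩; exact ⟨b, Submodule.mem_top, by simp⟩
    have hres : ∀ {N N' : Type u} [AddCommGroup N] [Module R N] [AddCommGroup N'] [Module R N']
        (φ : N →ₗ[R] N'), ∀ x ∈ torsionBy R N t, φ x ∈ torsionBy R N' t := by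
      intro N N' _ _ _ _ φ x hx
      rw [mem_torsionBy_iff] at hx ⊢
      rw [← map_smul, hx, map_zero]
    have hq : ∀ {N N' : Type u} [AddCommGroup N] [Module R N] [AddCommGroup N'] [Module R N']
        (φ : N →ₗ[R] N'), (Ideal.span {t} • ⊤ : Submodule R N) ≤
          Submodule.comap φ (Ideal.span {t} • ⊤ : Submodule R N') := by
      intro N N' _ _ _ _ φ
      rw [← Submodule.map_le_iff_le_comap, Submodule.map_smul'']
      exact Submodule.smul_mono le_rfl le_top
    let F₀ : torsionBy R N₁ t →ₗ[R] torsionBy R N₂ t := f.restrict (hres f)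
    let F : torsionBy R N₂ t →ₗ[R] torsionBy R N₃ t := g.restrict (hres g)
    let G : (N₁ ⧸ (Ideal.span {t} • ⊤ : Submodule R N₁)) →ₗ[R]
        (N₂ ⧸ (Ideal.span {t} • ⊤ : Submodule R N₂)) := Submodule.mapQ _ _ f (hq f)
    let G₂ : (N₂ ⧸ (Ideal.span {t} • ⊤ : Submodule R N₂)) →ₗ[R]
        (N₃ ⧸ (Ideal.span {t} • ⊤ : Submodule R N₃)) := Submodule.mapQ _ _ g (hq g)
    have hF : g ∘ₗ (torsionBy R N₂ t).subtype = (torsionBy R N₃ t).subtype ∘ₗ F := by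
      ext x; rfl
    have hG : G ∘ₗ (Ideal.span {t} • ⊤ : Submodule R N₁).mkQ =
        (Ideal.span {t} • ⊤ : Submodule R N₂).mkQ ∘ₗ f := by
      ext x; rfl
    let δ := SnakeLemma.δ' i₁' i₂' i₃' f g hfg f g hfg hc₁ hc₂ (torsionBy R N₃ t).subtype hι
      (Ideal.span {t} • ⊤ : Submodule R N₁).mkQ hπ hg hf
    have ex₂ : Exact F δ :=
      SnakeLemma.exact_δ'_right i₁' i₂' i₃' f g hfg f g hfg hc₁ hc₂ (torsionBy R N₂ t).subtype hι
        (torsionBy R N₃ t).subtype hι _ hπ hg hf F hF Subtype.val_injective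
    have ex₃ : Exact δ G :=
      SnakeLemma.exact_δ'_left i₁' i₂' i₃' f g hfg f g hfg hc₁ hc₂ (torsionBy R N₃ t).subtype hι
        _ hπ (Ideal.span {t} • ⊤ : Submodule R N₂).mkQ hπ hg hf G hG
        (Submodule.mkQ_surjective _)
    have hF₀ : Injective F₀ := fun x y hxy => Subtype.ext (hf (congrArg Subtype.val hxy))
    have ex₁ : Exact F₀ F := by
      intro y
      constructor
      · intro hy
        have hgy : g (y : N₂) = 0 := congrArg Subtype.val hy
        obtain ⟨x, hx⟩ := (hfg (y : N₂)).mp hgy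
        have hxt : x ∈ torsionBy R N₁ t := by
          rw [mem_torsionBy_iff]
          apply hf
          rw [map_smul, hx, map_zero]
          exact (mem_torsionBy_iff t (y : N₂)).mp y.2
        exact ⟨⟨x, hxt⟩, Subtype.ext hx⟩
      · rintro ⟨x, rfl⟩
        exact Subtype.ext (hfg.apply_apply_eq_zero (x : N₁))
    have ex₄ : Exact G G₂ := by
      intro z
      constructor
      · intro hz
        obtain ⟨y, rfl⟩ := Submodule.mkQ_surjective _ z
        have hz' : (Ideal.span {t} • ⊤ : Submodule R N₃).mkQ (g y) = 0 := hz
        obtain ⟨b, hb⟩ := (hπ (g y)).mp hz'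
        obtain ⟨y', rfl⟩ := hg b
        have hker : g (y - t • y') = 0 := by
          rw [map_sub, map_smul, ← hb]; simp
        obtain ⟨x, hx⟩ := (hfg _).mp hker
        refine ⟨(Ideal.span {t} • ⊤ : Submodule R N₁).mkQ x, ?_⟩
        change (Ideal.span {t} • ⊤ : Submodule R N₂).mkQ (f x) =
          (Ideal.span {t} • ⊤ : Submodule R N₂).mkQ y
        rw [hx, map_sub, sub_eq_self]
        exact (hπ (t • y')).mpr ⟨y', by simp⟩
      · rintro ⟨w', rfl⟩
        obtain ⟨x, rfl⟩ := Submodule.mkQ_surjective _ w'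
        change (Ideal.span {t} • ⊤ : Submodule R N₃).mkQ (g (f x)) = 0
        rw [hfg.apply_apply_eq_zero, map_zero]
    have hG₂ : Surjective G₂ := by
      intro w'
      obtain ⟨z, rfl⟩ := Submodule.mkQ_surjective _ w'
      obtain ⟨y, rfl⟩ := hg z
      exact ⟨(Ideal.span {t} • ⊤ : Submodule R N₂).mkQ y, rfl⟩
    -- pass to `ℤ_p`-linear maps and count `ℤ_p`-ranks
    haveI := moduleFinite_int_torsionBy p hw N₁
    haveI := moduleFinite_int_torsionBy p hw N₂
    haveI := moduleFinite_int_torsionBy p hw N₃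
    haveI := moduleFinite_int_quotient_smul_top p hw N₁
    haveI := moduleFinite_int_quotient_smul_top p hw N₂
    haveI := moduleFinite_int_quotient_smul_top p hw N₃
    have h6 := finrank_alternatingSum_six_eq_zero (A := ℤ_[p])
      (F₀.restrictScalars ℤ_[p]) (F.restrictScalars ℤ_[p]) (δ.restrictScalars ℤ_[p])
      (G.restrictScalars ℤ_[p]) (G₂.restrictScalars ℤ_[p]) hF₀ ex₁ ex₂ ex₃ ex₄ hG₂
    have hd : (w.natDegree : ℤ) * Module.finrank R N₂ =
        w.natDegree * Module.finrank R N₁ + w.natDegree * Module.finrank R N₃ := by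
      rw [hR]; ring
    rw [hd, ← E₁', ← E₃']
    linarith

/-- **`rank_{ℤ_p}(X/fX) = deg f · rank_Λ X + rank_{ℤ_p}(X[f])`** (the rank formula in `ℕ`, instance form).
[cite: Washington1997, §13.2 (Lemma 13.7, Prop. 13.8, Thm. 13.12)] -/
theorem finrank_quotient_eq_natDegree_mul_add_finrank_torsionBy {w : ℤ_[p][X]}
    (hw : w.IsDistinguishedAt (IsLocalRing.maximalIdeal ℤ_[p])) (Q : Type u) [AddCommGroup Q]
    [Module (IwasawaAlgebra p) Q] [Module ℤ_[p] Q] [IsScalarTower ℤ_[p] (IwasawaAlgebra p) Q]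
    [Module.Finite (IwasawaAlgebra p) Q] :
    Module.finrank ℤ_[p] (Q ⧸ (Ideal.span {(w : IwasawaAlgebra p)} • ⊤ :
        Submodule (IwasawaAlgebra p) Q)) =
      w.natDegree * Module.finrank (IwasawaAlgebra p) Q +
        Module.finrank ℤ_[p] (torsionBy (IwasawaAlgebra p) Q (w : IwasawaAlgebra p)) := by
  have h := finrank_quotient_sub_finrank_torsionBy_eq p hw Q
  omega

end Summit.BirchSwinnertonDyer.BirchSwinnertonDyer.Theorems.UniversalToricDescentTorsionFreeByCount

end
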